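import Summits.CriticalPhenomena.PercolationContinuityZ3.Theorems.PercLowPointHalfSpaceQuantitativeBGNWallDefs
import Summits.CriticalPhenomena.PercolationContinuityZ3.Theorems.PercLowPointHalfSpaceQuantitativeBGNWallTransfer
import Summits.CriticalPhenomena.PercolationContinuityZ3.Theorems.PercLowPointHalfSpaceQuantitativeBGNWallBootstrap
import Summits.CriticalPhenomena.PercolationContinuityZ3.Theorems.PercLowPointHalfSpaceQuantitativeBGNWallTwoGhost
import Mathlib.Analysis.SpecialFunctions.Pow.Real
import HarnessLib

/-!
# `QuantitativeBGN` (stmt-CriticalPhenomena-0913), line `longrange-wall-ghost-bootstrap` — the composition, kernel-checked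

Crux `Summit.CriticalPhenomena.PercolationContinuityZ3.Theses.PercLowPointHalfSpace.QuantitativeBGN`
(`∃ a C, 0 < a ∧ ∀ r ≥ 1, P_{p_c(ℤ³)}(arm_H(0,r)) ≤ C r^{-a}`), line `longrange-wall-ghost-bootstrap`
(skeleton `Cruxes/QuantitativeBGN/Lines/longrange_wall_ghost_bootstrap.lean`, lead c4). The line's three
provable stubs are LANDED — the basic wall two-ghost inequality K1 (`stub_wallTwoGhost`,
`…WallTwoGhost*.lean`), Hutchcroft's bootstrap on the wall (`stub_wallBootstrap`, exponent `(1-α)/4`,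
`…WallBootstrap{Prep,}.lean`) and the transfer to `p_c` (`stub_wallTransfer`, `…WallTransfer.lean`) —
so the composition of the line is now a theorem with exactly the two OPEN stubs as hypotheses, spelled
out over the WallDefs vocabulary (`clusterH`, `footAt`, `footGe`, `augWall`) and the crux's event `armH`:

* `footprintTail_of_wallStable` — K2_T (`stub_wallStable`: for some `α ∈ (0,1)`, `λ > 0`, the wall
  enhanced by long-range bonds `1 - exp(-λ‖u-v‖^{-(2+α)})` has finite mean `H`-cluster at every bulk
  density `p < p_c`) ALONE implies a polynomial tail for the critical half-space FOOTPRINT: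
  `∃ θ > 0, B: P_{p_c}(|C_H(0) ∩ ∂H| ≥ n) ≤ B n^{-θ}` (`FootprintTail`).
* `footprintTail_of_quantitativeBGN` — conversely the crux implies `FootprintTail` (with `θ = a/2`): a
  footprint of `n` wall vertices does not fit inside the wall box of side `2r - 1` when `(2r-1)² < n`, so
  `{F ≥ n} ⊆ arm_H(0, ⌊√n⌋/2)`. Hence `FootprintTail` is a NECESSARY intermediate of the crux, weaker
  than it, and (by the next item) sufficient together with K3.
* `quantitativeBGN_of_footprintTail_of_thinFootTall` — `FootprintTail` + K3 (`stub_wallThinFootTall`: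
  thin-footed tall clusters are polynomially rare) give the crux:
  `u(r) ≤ P(arm, F ≤ ⌊r^δ⌋) + P(F ≥ ⌊r^δ⌋ + 1) ≤ C r^{-a} + B r^{-δθ}`.
* `quantitativeBGN_of_wallStable_of_thinFootTall` — K2_T + K3 give the crux BY NAME (the line).

No new definitions; all statements are spelled out. Nothing here is unconditional news about the
crux: the two hypotheses are the line's open stubs (lead c4's census: both crux-class).
-/

noncomputable section

namespace Summit.CriticalPhenomena.PercolationContinuityZ3.Theorems

open MeasureTheory Literature.Probability.Percolation Literature.Probability.LatticeModels
open Summit.CriticalPhenomena.PercolationContinuityZ3.Theorems.WallGhost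
open Summit.CriticalPhenomena.PercolationContinuityZ3.Theorems.QuantitativeBGN.Negative
  (armH QuantitativeBGNAt quantitativeBGN_iff)
open scoped ENNReal

namespace WallChain

/-- The footprint exponent produced by the wall line: `θ(α) = (1-α)/4`, positive for `α < 1`. [folklore] -/
theorem theta_pos {α : ℝ} (hα : α < 1) : 0 < (1 - α) / 4 := by linarith

/-- **K2_T + K1 + bootstrap + transfer**: a polynomial footprint tail at `p_c` with the explicit exponent
`(1-α)/4`, for the `α, λ` supplied by K2_T. [folklore] -/
theorem footprintTail_explicit {α lam : ℝ} (hα0 : 0 < α) (hα1 : α < 1) (hlam : 0 < lam)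
    (hsub : ∀ p : unitInterval, (p : ℝ) < criticalProb (zdGraph 3) (0 : Site 3) →
      ∫⁻ ω, ((clusterH ω 0).encard : ℝ≥0∞) ∂(augWall p lam α) < ⊤) :
    ∃ B : ℝ, ∀ n : ℕ, 1 ≤ n →
      (bondPercolation (zdGraph 3) (criticalProbI 3)).real (footGe 0 n) ≤ B * (n : ℝ) ^ (-((1 - α) / 4)) := by
  obtain ⟨B, hB⟩ := stub_wallBootstrap α lam hα0 hα1 hlam (stub_wallTwoGhost α lam hα0 hlam) hsub
  exact ⟨B, stub_wallTransfer α lam _ B hlam.le hB⟩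

/-- Counting: the wall points of `ℤ³` all of whose coordinates are `< r` in absolute value number at most
`(2r-1)²` — they inject into `Fin (2r-1) × Fin (2r-1)` by `(v 1 + (r-1), v 2 + (r-1))`. [folklore] -/
theorem encard_wall_small_le (r : ℕ) :
    ({v : Site 3 | v 0 = 0 ∧ ∀ i : Fin 3, |v i| < (r : ℤ)}).encard ≤ (((2 * r - 1) ^ 2 : ℕ) : ℕ∞) := by
  classical
  rcases Nat.eq_zero_or_pos r with hr | hr
  · subst hr
    have : {v : Site 3 | v 0 = 0 ∧ ∀ i : Fin 3, |v i| < ((0 : ℕ) : ℤ)} = ∅ := by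
      ext v
      simp only [Set.mem_setOf_eq, Set.mem_empty_iff_false, iff_false, not_and, not_forall, not_lt]
      intro _
      exact ⟨0, by push_cast; exact abs_nonneg _⟩
    rw [this, Set.encard_empty]
    exact bot_le
  -- an injection into a finite type of the right cardinality
  set T : Set (Site 3) := {v : Site 3 | v 0 = 0 ∧ ∀ i : Fin 3, |v i| < (r : ℤ)} with hT
  let f : Site 3 → Fin (2 * r - 1) × Fin (2 * r - 1) := fun v =>
    (⟨(v 1 + (r - 1 : ℕ)).toNat % (2 * r - 1), Nat.mod_lt _ (by omega)⟩,
     ⟨(v 2 + (r - 1 : ℕ)).toNat % (2 * r - 1), Nat.mod_lt _ (by omega)⟩)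
  have hinj : Set.InjOn f T := by
    intro v hv w hw hvw
    simp only [hT, Set.mem_setOf_eq] at hv hw
    obtain ⟨hv0, hvi⟩ := hv
    obtain ⟨hw0, hwi⟩ := hw
    have hv1 := hvi 1; have hv2 := hvi 2; have hw1 := hwi 1; have hw2 := hwi 2
    rw [abs_lt] at hv1 hv2 hw1 hw2
    simp only [f, Prod.mk.injEq, Fin.mk.injEq] at hvw
    obtain ⟨h1, h2⟩ := hvw
    have key : ∀ a b : ℤ, -(r : ℤ) < a → a < r → -(r : ℤ) < b → b < r →
        (a + (r - 1 : ℕ)).toNat % (2 * r - 1) = (b + (r - 1 : ℕ)).toNat % (2 * r - 1) → a = b := by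
      intro a b ha1 ha2 hb1 hb2 hab
      have ha0 : 0 ≤ a + (r - 1 : ℕ) := by omega
      have hb0 : 0 ≤ b + (r - 1 : ℕ) := by omega
      have halt : (a + (r - 1 : ℕ)).toNat < 2 * r - 1 := by
        have : a + (r - 1 : ℕ) < ((2 * r - 1 : ℕ) : ℤ) := by omega
        exact (Int.toNat_lt ha0).2 this
      have hblt : (b + (r - 1 : ℕ)).toNat < 2 * r - 1 := by
        have : b + (r - 1 : ℕ) < ((2 * r - 1 : ℕ) : ℤ) := by omega
        exact (Int.toNat_lt hb0).2 this
      rw [Nat.mod_eq_of_lt halt, Nat.mod_eq_of_lt hblt] at hab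
      have := congrArg (fun n : ℕ => (n : ℤ)) hab
      simp only [Int.toNat_of_nonneg ha0, Int.toNat_of_nonneg hb0] at this
      omega
    have e1 : v 1 = w 1 := key _ _ hv1.1 hv1.2 hw1.1 hw1.2 h1
    have e2 : v 2 = w 2 := key _ _ hv2.1 hv2.2 hw2.1 hw2.2 h2
    funext i
    fin_cases i
    · exact hv0.trans hw0.symm
    · exact e1
    · exact e2
  calc T.encard = (f '' T).encard := (hinj.encard_image).symm
    _ ≤ (Set.univ : Set (Fin (2 * r - 1) × Fin (2 * r - 1))).encard :=
        Set.encard_le_encard (Set.subset_univ _)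
    _ = (((2 * r - 1) ^ 2 : ℕ) : ℕ∞) := by
        rw [Set.encard_univ, ENat.card_eq_coe_fintype_card]
        simp [sq]

/-- **A large footprint forces a long boundary arm**: if `(2r-1)² < n` then `{F ≥ n} ⊆ arm_H(0,r)` — some
vertex of the footprint has a coordinate of absolute value `≥ r`, and it is joined to `0` inside `H`.
[folklore] -/
theorem footGe_subset_armH {n r : ℕ} (h : (2 * r - 1) ^ 2 < n) : footGe 0 n ⊆ armH r := by
  intro ω hω
  rw [mem_footGe] at hω
  by_contra harm
  -- every footprint vertex has all coordinates `< r`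
  have hsub : clusterH ω 0 ∩ {v : Site 3 | v 0 = 0} ⊆ {v : Site 3 | v 0 = 0 ∧ ∀ i : Fin 3, |v i| < (r : ℤ)} := by
    rintro v ⟨hv, hv0⟩
    refine ⟨hv0, fun i => ?_⟩
    by_contra hi
    exact harm ⟨v, ⟨i, not_lt.1 hi⟩, (mem_clusterH.1 hv)⟩
  have hle : (n : ℕ∞) ≤ (((2 * r - 1) ^ 2 : ℕ) : ℕ∞) :=
    hω.trans ((Set.encard_le_encard hsub).trans (encard_wall_small_le r))
  exact absurd (by exact_mod_cast hle : n ≤ (2 * r - 1) ^ 2) (not_le.2 h)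

/-- With `r = ⌊√n⌋ / 2` one has `(2r-1)² < n` for `n ≥ 1`. [folklore] -/
theorem sq_pred_two_mul_sqrt_div_two_lt {n : ℕ} (hn : 1 ≤ n) : (2 * (Nat.sqrt n / 2) - 1) ^ 2 < n := by
  have h1 : 2 * (Nat.sqrt n / 2) - 1 < Nat.sqrt n ∨ Nat.sqrt n = 0 := by omega
  rcases h1 with h1 | h1
  · calc (2 * (Nat.sqrt n / 2) - 1) ^ 2 ≤ (2 * (Nat.sqrt n / 2) - 1) * Nat.sqrt n := by
          rw [sq]; exact Nat.mul_le_mul_left _ h1.le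
      _ < n := by
          rcases Nat.eq_zero_or_pos (2 * (Nat.sqrt n / 2) - 1) with h0 | h0
          · rw [h0, zero_mul]; omega
          · calc (2 * (Nat.sqrt n / 2) - 1) * Nat.sqrt n < Nat.sqrt n * Nat.sqrt n :=
                  Nat.mul_lt_mul_of_pos_right h1 (by omega)
              _ ≤ n := Nat.sqrt_le n
  · have : Nat.sqrt n / 2 = 0 := by rw [h1]
    rw [this]
    norm_num
    omega

/-- `⌊√n⌋ / 2 ≥ √n / 8` for `n ≥ 16`. [folklore] -/
theorem sqrt_div_eight_le {n : ℕ} (hn : 16 ≤ n) : Real.sqrt n / 8 ≤ ((Nat.sqrt n / 2 : ℕ) : ℝ) := by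
  have h4 : 4 ≤ Nat.sqrt n := by
    rw [Nat.le_sqrt]; omega
  -- `√n < ⌊√n⌋ + 1 ≤ 2 ⌊√n⌋ - ...`; we use `√n ≤ ⌊√n⌋ + 1` and `⌊√n⌋/2 ≥ (⌊√n⌋ - 1)/2`
  have hs : Real.sqrt n ≤ (Nat.sqrt n : ℝ) + 1 := by
    have := (Nat.lt_succ_sqrt n).le   -- n ≤ (sqrt n + 1) * (sqrt n + 1)
    have h' : (n : ℝ) ≤ ((Nat.sqrt n : ℝ) + 1) ^ 2 := by
      rw [sq]; exact_mod_cast this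
    calc Real.sqrt n ≤ Real.sqrt (((Nat.sqrt n : ℝ) + 1) ^ 2) := Real.sqrt_le_sqrt h'
      _ = (Nat.sqrt n : ℝ) + 1 := Real.sqrt_sq (by positivity)
  have hdiv : ((Nat.sqrt n : ℝ) - 1) / 2 ≤ ((Nat.sqrt n / 2 : ℕ) : ℝ) := by
    have : Nat.sqrt n ≤ 2 * (Nat.sqrt n / 2) + 1 := by omega
    have : (Nat.sqrt n : ℝ) ≤ 2 * ((Nat.sqrt n / 2 : ℕ) : ℝ) + 1 := by exact_mod_cast this
    linarith
  have h4' : (4 : ℝ) ≤ Nat.sqrt n := by exact_mod_cast h4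
  calc Real.sqrt n / 8 ≤ ((Nat.sqrt n : ℝ) + 1) / 8 := by gcongr
    _ ≤ ((Nat.sqrt n : ℝ) - 1) / 2 := by linarith
    _ ≤ _ := hdiv

end WallChain

open WallChain

/-- **K2_T ⟹ FootprintTail.** If for some `α ∈ (0,1)` and `λ > 0` the wall augmented by the long-range bonds
`1 - exp(-λ‖u-v‖^{-(2+α)})` has finite mean `H`-cluster at every bulk density `p < p_c(ℤ³)` (the line's OPEN
stub `stub_wallStable`), then the footprint of the critical half-space cluster has a polynomial tail:
`∃ θ > 0, B, ∀ n ≥ 1, P_{p_c}(|C_H(0) ∩ ∂H| ≥ n) ≤ B n^{-θ}` (with `θ = (1-α)/4`). Composition of the landed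
`stub_wallTwoGhost`, `stub_wallBootstrap`, `stub_wallTransfer`. [folklore] -/
theorem WallChain.footprintTail_of_wallStable'
    (h : ∃ α lam : ℝ, 0 < α ∧ α < 1 ∧ 0 < lam ∧ ∀ p : unitInterval, (p : ℝ) < criticalProb (zdGraph 3) (0 : Site 3) → ∫⁻ ω, ((clusterH ω 0).encard : ℝ≥0∞) ∂(augWall p lam α) < ⊤) :
    ∃ θ B : ℝ, 0 < θ ∧ ∀ n : ℕ, 1 ≤ n → (bondPercolation (zdGraph 3) (criticalProbI 3)).real (footGe 0 n) ≤ B * (n : ℝ) ^ (-θ) := by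
  obtain ⟨α, lam, hα0, hα1, hlam, hsub⟩ := h
  obtain ⟨B, hB⟩ := footprintTail_explicit hα0 hα1 hlam hsub
  exact ⟨(1 - α) / 4, B, theta_pos hα1, hB⟩

/-- **The crux ⟹ FootprintTail** (so `FootprintTail` is a necessary intermediate): from
`P_{p_c}(arm_H(0,r)) ≤ C r^{-a}` (`r ≥ 1`) one gets `P_{p_c}(F ≥ n) ≤ B n^{-a/2}`, because `{F ≥ n} ⊆ arm_H(0, ⌊√n⌋/2)`
(`footGe_subset_armH`) and `⌊√n⌋/2 ≥ √n/8` for `n ≥ 16` (small `n` are absorbed in the constant). [folklore] -/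
theorem WallChain.footprintTail_of_quantitativeBGN'
    (h : Summit.CriticalPhenomena.PercolationContinuityZ3.Theses.PercLowPointHalfSpace.QuantitativeBGN) :
    ∃ θ B : ℝ, 0 < θ ∧ ∀ n : ℕ, 1 ≤ n → (bondPercolation (zdGraph 3) (criticalProbI 3)).real (footGe 0 n) ≤ B * (n : ℝ) ^ (-θ) := by
  obtain ⟨a, C, ha, hC⟩ := quantitativeBGN_iff.1 h
  set μ := bondPercolation (zdGraph 3) (criticalProbI 3) with hμ
  -- constants: `B₁` handles `n ≥ 16`, `B₀ = 16^{a/2}` handles `n < 16`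
  refine ⟨a / 2, max (max C 0 * (8 : ℝ) ^ a) ((16 : ℝ) ^ (a / 2)), half_pos ha, fun n hn => ?_⟩
  have hn0 : (0 : ℝ) < n := by exact_mod_cast hn
  by_cases h16 : 16 ≤ n
  · -- large `n`: go through the arm event at radius `r = ⌊√n⌋/2 ≥ 2`
    set r : ℕ := Nat.sqrt n / 2 with hr
    have hr1 : 1 ≤ r := by
      have : 4 ≤ Nat.sqrt n := by rw [Nat.le_sqrt]; omega
      omega
    have hr0 : (0 : ℝ) < r := by exact_mod_cast hr1
    have hsub : footGe 0 n ⊆ armH r := footGe_subset_armH (sq_pred_two_mul_sqrt_div_two_lt hn)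
    have hstep1 : μ.real (footGe 0 n) ≤ C * (r : ℝ) ^ (-a) := (measureReal_mono hsub).trans (hC r hr1)
    -- compare `r^{-a}` with `n^{-a/2}` using `r ≥ √n/8`
    have hr_ge : Real.sqrt n / 8 ≤ (r : ℝ) := sqrt_div_eight_le h16
    have hsqrt_pos : 0 < Real.sqrt n / 8 := by positivity
    have hpow : (r : ℝ) ^ (-a) ≤ (8 : ℝ) ^ a * (n : ℝ) ^ (-(a / 2)) := by
      calc (r : ℝ) ^ (-a) ≤ (Real.sqrt n / 8) ^ (-a) :=
            Real.rpow_le_rpow_of_nonpos hsqrt_pos hr_ge (by linarith)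
        _ = (8 : ℝ) ^ a * (n : ℝ) ^ (-(a / 2)) := by
            rw [div_eq_mul_inv, Real.mul_rpow (Real.sqrt_nonneg _) (by norm_num), Real.sqrt_eq_rpow,
              ← Real.rpow_mul hn0.le, Real.inv_rpow (by norm_num), ← Real.rpow_neg (by norm_num), neg_neg]
            ring_nf
    calc μ.real (footGe 0 n) ≤ C * (r : ℝ) ^ (-a) := hstep1
      _ ≤ max C 0 * (r : ℝ) ^ (-a) := mul_le_mul_of_nonneg_right (le_max_left _ _) (Real.rpow_nonneg hr0.le _)
      _ ≤ max C 0 * ((8 : ℝ) ^ a * (n : ℝ) ^ (-(a / 2))) := mul_le_mul_of_nonneg_left hpow (le_max_right _ _)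
      _ = (max C 0 * (8 : ℝ) ^ a) * (n : ℝ) ^ (-(a / 2)) := by ring
      _ ≤ _ := mul_le_mul_of_nonneg_right (le_max_left _ _) (Real.rpow_nonneg hn0.le _)
  · -- small `n`: the probability is at most `1 ≤ 16^{a/2} n^{-a/2}`
    have hn16 : (n : ℝ) ≤ 16 := by exact_mod_cast (not_le.1 h16).le
    have h1 : (1 : ℝ) ≤ (16 : ℝ) ^ (a / 2) * (n : ℝ) ^ (-(a / 2)) := by
      rw [Real.rpow_neg hn0.le, ← div_eq_mul_inv, le_div_iff₀ (Real.rpow_pos_of_pos hn0 _), one_mul]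
      exact Real.rpow_le_rpow hn0.le hn16 (by linarith)
    calc μ.real (footGe 0 n) ≤ 1 := measureReal_le_one
      _ ≤ (16 : ℝ) ^ (a / 2) * (n : ℝ) ^ (-(a / 2)) := h1
      _ ≤ _ := mul_le_mul_of_nonneg_right (le_max_right _ _) (Real.rpow_nonneg hn0.le _)

/-- **FootprintTail + K3 ⟹ the crux.** A polynomial footprint tail at `p_c` (any `θ > 0`) together with the line's
OPEN stub K3 `stub_wallThinFootTall` (`P_{p_c}(arm_H(0,r), F ≤ ⌊r^δ⌋) ≤ C r^{-a}`) gives `QuantitativeBGN`: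
`u(r) ≤ P(arm, F ≤ ⌊r^δ⌋) + P(F ≥ ⌊r^δ⌋+1) ≤ C r^{-a} + B r^{-δθ} ≤ (C⁺ + B⁺) r^{-min(a, δθ)}`. [folklore] -/
theorem WallChain.quantitativeBGN_of_footprintTail_of_thinFootTall'
    (hF : ∃ θ B : ℝ, 0 < θ ∧ ∀ n : ℕ, 1 ≤ n → (bondPercolation (zdGraph 3) (criticalProbI 3)).real (footGe 0 n) ≤ B * (n : ℝ) ^ (-θ))
    (h₅ : ∃ a δ C : ℝ, 0 < a ∧ 0 < δ ∧ ∀ r : ℕ, 1 ≤ r → (bondPercolation (zdGraph 3) (criticalProbI 3)).real (armH r ∩ {ω | footAt ω 0 ≤ ((⌊(r : ℝ) ^ δ⌋₊ : ℕ) : ℕ∞)}) ≤ C * (r : ℝ) ^ (-a)) :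
    Summit.CriticalPhenomena.PercolationContinuityZ3.Theses.PercLowPointHalfSpace.QuantitativeBGN := by
  obtain ⟨θ, B, hθ, hcrit⟩ := hF
  obtain ⟨a, δ, C, ha, hδ, hT⟩ := h₅
  refine quantitativeBGN_iff.2 ⟨min a (δ * θ), max C 0 + max B 0, lt_min ha (mul_pos hδ hθ), fun r hr => ?_⟩
  set μc := bondPercolation (zdGraph 3) (criticalProbI 3) with hμc
  have hr0 : (0 : ℝ) < r := by exact_mod_cast hr
  have hr1 : (1 : ℝ) ≤ r := by exact_mod_cast hr
  -- split the arm event along the footprint threshold ⌊r^δ⌋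
  have hsplit : armH r ⊆ (armH r ∩ {ω | footAt ω 0 ≤ ((⌊(r : ℝ) ^ δ⌋₊ : ℕ) : ℕ∞)}) ∪
      footGe 0 (⌊(r : ℝ) ^ δ⌋₊ + 1) := by
    intro ω hω
    by_cases hle : footAt ω 0 ≤ ((⌊(r : ℝ) ^ δ⌋₊ : ℕ) : ℕ∞)
    · exact Or.inl ⟨hω, hle⟩
    · refine Or.inr ?_
      change ((⌊(r : ℝ) ^ δ⌋₊ + 1 : ℕ) : ℕ∞) ≤ footAt ω 0
      push_cast
      exact (ENat.add_one_le_iff (ENat.coe_ne_top _)).2 (not_le.1 hle)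
  have hle1 : μc.real (armH r) ≤
      μc.real (armH r ∩ {ω | footAt ω 0 ≤ ((⌊(r : ℝ) ^ δ⌋₊ : ℕ) : ℕ∞)}) +
        μc.real (footGe 0 (⌊(r : ℝ) ^ δ⌋₊ + 1)) :=
    (measureReal_mono hsplit).trans (measureReal_union_le _ _)
  have hA := hT r hr
  have hBn := hcrit (⌊(r : ℝ) ^ δ⌋₊ + 1) (Nat.succ_le_succ (Nat.zero_le _))
  have hmr : (r : ℝ) ^ δ ≤ ((⌊(r : ℝ) ^ δ⌋₊ + 1 : ℕ) : ℝ) := by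
    push_cast
    exact (Nat.lt_floor_add_one _).le
  have hpow1 : ((⌊(r : ℝ) ^ δ⌋₊ + 1 : ℕ) : ℝ) ^ (-θ) ≤ (r : ℝ) ^ (-(δ * θ)) := by
    calc ((⌊(r : ℝ) ^ δ⌋₊ + 1 : ℕ) : ℝ) ^ (-θ)
        ≤ ((r : ℝ) ^ δ) ^ (-θ) :=
          Real.rpow_le_rpow_of_nonpos (Real.rpow_pos_of_pos hr0 δ) hmr (by linarith)
      _ = (r : ℝ) ^ (-(δ * θ)) := by
          rw [← Real.rpow_mul hr0.le]
          congr 1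
          ring
  have hpow2 : (r : ℝ) ^ (-(δ * θ)) ≤ (r : ℝ) ^ (-(min a (δ * θ))) :=
    Real.rpow_le_rpow_of_exponent_le hr1 (neg_le_neg (min_le_right _ _))
  have hpow3 : (r : ℝ) ^ (-a) ≤ (r : ℝ) ^ (-(min a (δ * θ))) :=
    Real.rpow_le_rpow_of_exponent_le hr1 (neg_le_neg (min_le_left _ _))
  calc μc.real (armH r)
      ≤ μc.real (armH r ∩ {ω | footAt ω 0 ≤ ((⌊(r : ℝ) ^ δ⌋₊ : ℕ) : ℕ∞)}) +
          μc.real (footGe 0 (⌊(r : ℝ) ^ δ⌋₊ + 1)) := hle1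
    _ ≤ C * (r : ℝ) ^ (-a) + B * ((⌊(r : ℝ) ^ δ⌋₊ + 1 : ℕ) : ℝ) ^ (-θ) := add_le_add hA hBn
    _ ≤ max C 0 * (r : ℝ) ^ (-(min a (δ * θ))) + max B 0 * (r : ℝ) ^ (-(min a (δ * θ))) := by
          apply add_le_add
          · calc C * (r : ℝ) ^ (-a) ≤ max C 0 * (r : ℝ) ^ (-a) :=
                  mul_le_mul_of_nonneg_right (le_max_left _ _) (Real.rpow_nonneg hr0.le _)
              _ ≤ max C 0 * (r : ℝ) ^ (-(min a (δ * θ))) :=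
                  mul_le_mul_of_nonneg_left hpow3 (le_max_right _ _)
          · calc B * ((⌊(r : ℝ) ^ δ⌋₊ + 1 : ℕ) : ℝ) ^ (-θ)
                ≤ max B 0 * ((⌊(r : ℝ) ^ δ⌋₊ + 1 : ℕ) : ℝ) ^ (-θ) :=
                  mul_le_mul_of_nonneg_right (le_max_left _ _) (Real.rpow_nonneg (by positivity) _)
              _ ≤ max B 0 * (r : ℝ) ^ (-(min a (δ * θ))) :=
                  mul_le_mul_of_nonneg_left (hpow1.trans hpow2) (le_max_right _ _)
    _ = (max C 0 + max B 0) * (r : ℝ) ^ (-(min a (δ * θ))) := by ring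

/-- **The line `longrange-wall-ghost-bootstrap`, kernel-checked modulo its two open stubs**: K2_T
(`stub_wallStable`) and K3 (`stub_wallThinFootTall`) imply the crux
`Summit.CriticalPhenomena.PercolationContinuityZ3.Theses.PercLowPointHalfSpace.QuantitativeBGN` BY NAME
(the landed K1 / bootstrap / transfer are discharged inside). [folklore] -/
theorem WallChain.quantitativeBGN_of_wallStable_of_thinFootTall'
    (h₁ : ∃ α lam : ℝ, 0 < α ∧ α < 1 ∧ 0 < lam ∧ ∀ p : unitInterval, (p : ℝ) < criticalProb (zdGraph 3) (0 : Site 3) → ∫⁻ ω, ((clusterH ω 0).encard : ℝ≥0∞) ∂(augWall p lam α) < ⊤)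
    (h₅ : ∃ a δ C : ℝ, 0 < a ∧ 0 < δ ∧ ∀ r : ℕ, 1 ≤ r → (bondPercolation (zdGraph 3) (criticalProbI 3)).real (armH r ∩ {ω | footAt ω 0 ≤ ((⌊(r : ℝ) ^ δ⌋₊ : ℕ) : ℕ∞)}) ≤ C * (r : ℝ) ^ (-a)) :
    Summit.CriticalPhenomena.PercolationContinuityZ3.Theses.PercLowPointHalfSpace.QuantitativeBGN :=
  WallChain.quantitativeBGN_of_footprintTail_of_thinFootTall' (WallChain.footprintTail_of_wallStable' h₁) h₅

/-! ## Registered forms (verbatim headers of the stubs registered on stmt-CriticalPhenomena-0913) -/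

/-- **K2_T ⟹ FootprintTail** (registered form of `WallChain.footprintTail_of_wallStable'`). [folklore] -/
theorem footprintTail_of_wallStable : (∃ α lam : ℝ, 0 < α ∧ α < 1 ∧ 0 < lam ∧ ∀ p : unitInterval, (p : ℝ) < criticalProb (zdGraph 3) (0 : Site 3) → ∫⁻ ω, ((clusterH ω 0).encard : ℝ≥0∞) ∂(augWall p lam α) < ⊤) → ∃ θ B : ℝ, 0 < θ ∧ ∀ n : ℕ, 1 ≤ n → (bondPercolation (zdGraph 3) (criticalProbI 3)).real (footGe 0 n) ≤ B * (n : ℝ) ^ (-θ) :=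
  fun h => WallChain.footprintTail_of_wallStable' h

/-- **The crux ⟹ FootprintTail** (registered form of `WallChain.footprintTail_of_quantitativeBGN'`). [folklore] -/
theorem footprintTail_of_quantitativeBGN : Summit.CriticalPhenomena.PercolationContinuityZ3.Theses.PercLowPointHalfSpace.QuantitativeBGN → ∃ θ B : ℝ, 0 < θ ∧ ∀ n : ℕ, 1 ≤ n → (bondPercolation (zdGraph 3) (criticalProbI 3)).real (footGe 0 n) ≤ B * (n : ℝ) ^ (-θ) :=
  fun h => WallChain.footprintTail_of_quantitativeBGN' h

/-- **FootprintTail + K3 ⟹ the crux** (registered form of `WallChain.quantitativeBGN_of_footprintTail_of_thinFootTall'`).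
[folklore] -/
theorem quantitativeBGN_of_footprintTail_of_thinFootTall : (∃ θ B : ℝ, 0 < θ ∧ ∀ n : ℕ, 1 ≤ n → (bondPercolation (zdGraph 3) (criticalProbI 3)).real (footGe 0 n) ≤ B * (n : ℝ) ^ (-θ)) → (∃ a δ C : ℝ, 0 < a ∧ 0 < δ ∧ ∀ r : ℕ, 1 ≤ r → (bondPercolation (zdGraph 3) (criticalProbI 3)).real (armH r ∩ {ω | footAt ω 0 ≤ ((⌊(r : ℝ) ^ δ⌋₊ : ℕ) : ℕ∞)}) ≤ C * (r : ℝ) ^ (-a)) → Summit.CriticalPhenomena.PercolationContinuityZ3.Theses.PercLowPointHalfSpace.QuantitativeBGN :=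
  fun hF h₅ => WallChain.quantitativeBGN_of_footprintTail_of_thinFootTall' hF h₅

/-- **K2_T + K3 ⟹ the crux BY NAME** — the line `longrange-wall-ghost-bootstrap` kernel-checked modulo its two open stubs
(registered form of `WallChain.quantitativeBGN_of_wallStable_of_thinFootTall'`). [folklore] -/
theorem quantitativeBGN_of_wallStable_of_thinFootTall : (∃ α lam : ℝ, 0 < α ∧ α < 1 ∧ 0 < lam ∧ ∀ p : unitInterval, (p : ℝ) < criticalProb (zdGraph 3) (0 : Site 3) → ∫⁻ ω, ((clusterH ω 0).encard : ℝ≥0∞) ∂(augWall p lam α) < ⊤) → (∃ a δ C : ℝ, 0 < a ∧ 0 < δ ∧ ∀ r : ℕ, 1 ≤ r → (bondPercolation (zdGraph 3) (criticalProbI 3)).real (armH r ∩ {ω | footAt ω 0 ≤ ((⌊(r : ℝ) ^ δ⌋₊ : ℕ) : ℕ∞)}) ≤ C * (r : ℝ) ^ (-a)) → Summit.CriticalPhenomena.PercolationContinuityZ3.Theses.PercLowPointHalfSpace.QuantitativeBGN :=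
  fun h₁ h₅ => WallChain.quantitativeBGN_of_wallStable_of_thinFootTall' h₁ h₅

/-! ## The crux splits exactly into its fat part and its thin part (appended by lead c4) -/

/-- **The crux ⟹ K3** (trivially: the thin-foot tall event is a sub-event of the arm event; take `δ = 1`). So K3,
like `FootprintTail`, is a NECESSARY part of the crux. [folklore] -/
theorem thinFootTall_of_quantitativeBGN : Summit.CriticalPhenomena.PercolationContinuityZ3.Theses.PercLowPointHalfSpace.QuantitativeBGN → (∃ a δ C : ℝ, 0 < a ∧ 0 < δ ∧ ∀ r : ℕ, 1 ≤ r → (bondPercolation (zdGraph 3) (criticalProbI 3)).real (armH r ∩ {ω | footAt ω 0 ≤ ((⌊(r : ℝ) ^ δ⌋₊ : ℕ) : ℕ∞)}) ≤ C * (r : ℝ) ^ (-a)) := by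
  intro h
  obtain ⟨a, C, ha, hC⟩ := quantitativeBGN_iff.1 h
  exact ⟨a, 1, C, ha, one_pos, fun r hr => (measureReal_mono Set.inter_subset_left).trans (hC r hr)⟩

/-- **`QuantitativeBGN ⟺ FootprintTail ∧ ThinFootTall`.** The crux (a polynomial rate for the boundary one-arm at
`p_c(ℤ³)`) is EQUIVALENT to the conjunction of its two necessary parts: the FAT part `FootprintTail`
(`∃ θ > 0, B, P_{p_c}(|C_H(0) ∩ ∂H| ≥ n) ≤ B n^{-θ}`, a volume-type tail for the wall footprint — the part the line
`longrange-wall-ghost-bootstrap` derives from K2_T) and the THIN part `ThinFootTall` (K3: `∃ a, δ > 0, C,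
P_{p_c}(arm_H(0,r), |C_H(0) ∩ ∂H| ≤ ⌊r^δ⌋) ≤ C r^{-a}`, an arm-type rate on the atypical thin-foot sub-event).
[folklore] -/
theorem quantitativeBGN_iff_footprintTail_and_thinFootTall : Summit.CriticalPhenomena.PercolationContinuityZ3.Theses.PercLowPointHalfSpace.QuantitativeBGN ↔ (∃ θ B : ℝ, 0 < θ ∧ ∀ n : ℕ, 1 ≤ n → (bondPercolation (zdGraph 3) (criticalProbI 3)).real (footGe 0 n) ≤ B * (n : ℝ) ^ (-θ)) ∧ (∃ a δ C : ℝ, 0 < a ∧ 0 < δ ∧ ∀ r : ℕ, 1 ≤ r → (bondPercolation (zdGraph 3) (criticalProbI 3)).real (armH r ∩ {ω | footAt ω 0 ≤ ((⌊(r : ℝ) ^ δ⌋₊ : ℕ) : ℕ∞)}) ≤ C * (r : ℝ) ^ (-a)) :=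
  ⟨fun h => ⟨footprintTail_of_quantitativeBGN h, thinFootTall_of_quantitativeBGN h⟩,
    fun h => quantitativeBGN_of_footprintTail_of_thinFootTall h.1 h.2⟩

end Summit.CriticalPhenomena.PercolationContinuityZ3.Theorems

end
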